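import Summits.AtomisticToContinuum.BoseEinsteinCondensation.Theses.BECInsertionCorrector
import Summits.AtomisticToContinuum.BoseEinsteinCondensation.Theorems.StaticResponseBound.Negative.Basic
import Summits.AtomisticToContinuum.BoseEinsteinCondensation.Theorems.BECInsertionCorrectorStaticResponseToHMinusOneEnvelope
import Summits.AtomisticToContinuum.BoseEinsteinCondensation.Theorems.BECInsertionCorrectorStaticResponseToHMinusOneEulerLagrange
import Literature.MathematicalPhysics.QuantumManyBody.GroundStateDirichletForm
import Literature.MathematicalPhysics.QuantumManyBody.PeriodicBoseGasMomentumSector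
import HarnessLib

/-!
# Energy floor in a momentum sector ⇒ Poincaré floor of the minimiser's weight — stub B4

Helper file for the crux `BECInsertionCorrector.StaticResponseBound` (item
stmt-AtomisticToContinuum-12057), line `stable-fraction-square-completion`: the registered stub
**B4** `stub_energyFloorToPoincareFloor` (statement verbatim from the checked skeleton of the
line).  If `Θ` is a real non-negative, translation-invariant periodic trial state ATTAINING the
finite periodic ground-state energy `E₀`, then an energy floor `E₀ + ω ≤ inf sp H(p)` in the
momentum sector `p = 2πm/L` transfers to the sectorial Poincaré constant of the weight `Θ`:
`ω ≤ ω_Θ(p)`.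

Proof (Davies' ground-state transform, for a COMPLEX Bloch test over a REAL minimiser).  By
`le_sectorPoincareConstant_iff` it suffices to show `ω ‖F‖²_Θ ≤ 𝓔_Θ(F)` for every Bloch-`p` test
`F` with `0 < ‖F‖²_Θ < ∞`.  The transform `Ψ_F = FΘ/‖FΘ‖` (`PeriodicTrialState.gsTransform`) lies in
the sector `p` (`momentumSectorEnergy_le_gsTransform`), so `E₀ + ω ≤ ⟨Ψ_F, HΨ_F⟩`.  With the
measurable weight `W` of `exists_measurable_weight` (`⟨Ψ,HΨ⟩ = ∫⁻|∇Ψ|² + W|Ψ|²` for all `Ψ`), write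
`F = F₁ + iF₂`, `Gᵢ = Fᵢ|Θ|`: `|∇(FΘ)|² = |∇G₁|² + |∇G₂|²`, `|FΘ|² = G₁² + G₂²`, and for each REAL
`C¹` lattice-periodic symmetric `θ` the weak Euler–Lagrange equation of the minimiser tested with
`θ²` (`StaticResponseToHMinusOne.eulerLagrange`) and the pointwise identity
`|∇(θ|Θ|)|² = ∇|Θ|·∇(θ²|Θ|) + |∇θ|²|Θ|²` give the unnormalised ground-state representation
`∫|∇(θ|Θ|)|² + ∫W(θ|Θ|)² = E₀∫(θ|Θ|)² + ∫|∇θ|²|Θ|²`.  Summing over `θ = F₁, F₂`: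
`⟨FΘ, H FΘ⟩ = E₀‖F‖²_Θ + 𝓔_Θ(F)`, whence `(E₀ + ω)‖F‖²_Θ ≤ E₀‖F‖²_Θ + 𝓔_Θ(F)` and, `E₀` being
finite, `ω‖F‖²_Θ ≤ 𝓔_Θ(F)`.  References: [Davies1989] §4.2 Thm 4.2.1; [CorneanDerezinskiZin2009]
§1.1 (1.6).  No new definitions.
-/

namespace Summit.AtomisticToContinuum.BoseEinsteinCondensation.Cruxes.StaticResponseBound.StableFractionSquareCompletion

open MeasureTheory Filter
open scoped ENNReal NNReal ComplexConjugate
open Literature.MathematicalPhysics.QuantumManyBody.BoseGas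
open Summit.AtomisticToContinuum.BoseEinsteinCondensation.Theses
open Summit.AtomisticToContinuum.BoseEinsteinCondensation.Theorems.StaticResponseBound.Negative
open Summit.AtomisticToContinuum.BoseEinsteinCondensation.Theorems.StaticResponseToHMinusOne
  (exists_measurable_weight eulerLagrange integrableOn_toReal_weight_mul_norm_sq
    ae_weight_mul_ofReal_eq)
open Summit.AtomisticToContinuum.BoseEinsteinCondensation.Cruxes.StaticResponseBound.UvThomsonForceWave
  (contDiff_norm_of_real exists_bound_on_cellN gradDot_mul_self_eq)

noncomputable section

variable {N : ℕ} {L : ℝ}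

/-! ### The kinetic density of a complex function in real form -/

/-- **The kinetic density splits into real and imaginary parts**: for a differentiable
`ψ : (ℝ³)^N → ℂ`, `|∇ψ|² = |∇ Re ψ|² + |∇ Im ψ|² = Γ(Re ψ, Re ψ) + Γ(Im ψ, Im ψ)` pointwise.
[folklore] -/
theorem b4_kineticDensity_eq_ofReal_gradDot {ψ : Config N → ℂ} (hψ : Differentiable ℝ ψ)
    (X : Config N) :
    kineticDensity ψ X = ENNReal.ofReal
      (gradDot (fun Y => (ψ Y).re) (fun Y => (ψ Y).re) X +
        gradDot (fun Y => (ψ Y).im) (fun Y => (ψ Y).im) X) := by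
  have hre : fderiv ℝ (fun Y => (ψ Y).re) X = Complex.reCLM.comp (fderiv ℝ ψ X) :=
    (Complex.reCLM.hasFDerivAt.comp X (hψ X).hasFDerivAt).fderiv
  have him : fderiv ℝ (fun Y => (ψ Y).im) X = Complex.imCLM.comp (fderiv ℝ ψ X) :=
    (Complex.imCLM.hasFDerivAt.comp X (hψ X).hasFDerivAt).fderiv
  unfold kineticDensity gradDot pderiv
  rw [hre, him, ← Finset.sum_add_distrib, ENNReal.ofReal_sum_of_nonneg fun i _ =>
    add_nonneg (Finset.sum_nonneg fun k _ => mul_self_nonneg _)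
      (Finset.sum_nonneg fun k _ => mul_self_nonneg _)]
  refine Finset.sum_congr rfl fun i _ => ?_
  rw [← Finset.sum_add_distrib,
    ENNReal.ofReal_sum_of_nonneg fun k _ => add_nonneg (mul_self_nonneg _) (mul_self_nonneg _)]
  refine Finset.sum_congr rfl fun k _ => ?_
  rw [coe_nnnorm_sq_eq_ofReal, Complex.sq_norm, Complex.normSq_apply]
  simp only [ContinuousLinearMap.comp_apply, Complex.reCLM_apply, Complex.imCLM_apply]

/-! ### The unnormalised ground-state representation for a real test function -/

section RealPart

variable {v : ℝ → ℝ≥0∞} {W : Config N → ℝ≥0∞} {Θ : PeriodicTrialState N L}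

/-- **Unnormalised ground-state representation (real test function).** For a measurable weight
`W` computing the periodic energy and a real nonnegative finite-energy minimiser `Θ` (value
`E₀ = ⟨Θ,HΘ⟩`), every real `C¹` lattice-periodic Bose-symmetric `θ` satisfies
`∫|∇(θ|Θ|)|² + ∫ W(θ|Θ|)² = E₀ ∫(θ|Θ|)² + ∫|∇θ|²|Θ|²` (the pointwise identity
`|∇(θ|Θ|)|² = ∇|Θ|·∇(θ²|Θ|) + |∇θ|²|Θ|²` and the weak Euler–Lagrange equation tested with `θ²`).
[cite: Davies1989, §4.2 Thm 4.2.1 (proof), pp. 109–110] -/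
theorem b4_real_gsRep (hW : Measurable W)
    (hEW : ∀ Ψ : PeriodicTrialState N L, periodicEnergy v Ψ =
      ∫⁻ X in cellN N L, kineticDensity Ψ.ψ X + W X * ((‖Ψ.ψ X‖₊ : ℝ≥0∞)) ^ 2)
    (hreal : ∀ X, Θ.ψ X = (‖Θ.ψ X‖ : ℂ)) (hfin : periodicEnergy v Θ ≠ ⊤)
    (hmin : ∀ Ψ : PeriodicTrialState N L, periodicEnergy v Θ ≤ periodicEnergy v Ψ)
    {θ : Config N → ℝ} (hθ : ContDiff ℝ 1 θ) (hθper : IsLatticePeriodic L θ)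
    (hθsymm : ∀ (σ : Equiv.Perm (Fin N)) (X : Config N), θ (X ∘ σ) = θ X) :
    (∫ X in cellN N L, gradDot (fun Y => θ Y * ‖Θ.ψ Y‖) (fun Y => θ Y * ‖Θ.ψ Y‖) X) +
        ∫ X in cellN N L, (W X).toReal * (θ X * ‖Θ.ψ X‖) ^ 2 =
      (periodicEnergy v Θ).toReal * (∫ X in cellN N L, (θ X * ‖Θ.ψ X‖) ^ 2) +
        dirichletFormW L (fun X => ‖Θ.ψ X‖) θ θ := by
  have hF : ContDiff ℝ 1 (fun X => ‖Θ.ψ X‖) := contDiff_norm_of_real Θ hreal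
  -- the Euler–Lagrange equation tested with `ζ = θ²`
  have hζ : ContDiff ℝ 1 fun X => θ X ^ 2 := hθ.pow 2
  have hζper : IsLatticePeriodic L fun X => θ X ^ 2 := fun X i a => by
    show θ _ ^ 2 = θ X ^ 2
    rw [hθper X i a]
  have hζsymm : ∀ (σ : Equiv.Perm (Fin N)) (X : Config N),
      (fun X => θ X ^ 2) (X ∘ σ) = (fun X => θ X ^ 2) X := fun σ X => by
    simp only [hθsymm σ X]
  have hEL := eulerLagrange hW hEW hreal hfin hmin hζ hζper hζsymm
  -- the kinetic identity, integrated
  have hkin : ∫ X in cellN N L, gradDot (fun Y => θ Y * ‖Θ.ψ Y‖) (fun Y => θ Y * ‖Θ.ψ Y‖) X =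
      (∫ X in cellN N L, gradDot (fun Y => ‖Θ.ψ Y‖) (fun Y => θ Y ^ 2 * ‖Θ.ψ Y‖) X) +
        dirichletFormW L (fun X => ‖Θ.ψ X‖) θ θ := by
    unfold dirichletFormW
    rw [← integral_add (integrableOn_cellN (continuous_gradDot hF (hζ.mul hF)) L)
      (integrableOn_gradDot_mul_sq hF.continuous hθ hθ L)]
    refine integral_congr_ae (ae_of_all _ fun X => ?_)
    exact gradDot_mul_self_eq (hθ.differentiable one_ne_zero X) (hF.differentiable one_ne_zero X)
  have hsq : ∀ X, (θ X * ‖Θ.ψ X‖) ^ 2 = θ X ^ 2 * ‖Θ.ψ X‖ ^ 2 := fun X => by ring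
  simp_rw [hsq]
  rw [hkin]
  have e1 : ∫ X in cellN N L, (W X).toReal * (θ X ^ 2 * ‖Θ.ψ X‖ ^ 2) =
      ∫ X in cellN N L, (W X).toReal * θ X ^ 2 * ‖Θ.ψ X‖ ^ 2 := by
    congr 1 with X; ring
  rw [e1]
  linarith [hEL]

/-- **The real-form energy of `θ|Θ|` as a lower integral.** In the setting of `b4_real_gsRep`,
`∫⁻_cell (ofReal |∇(θ|Θ|)|² + W · ofReal (θ|Θ|)²) = ofReal (E₀ ∫(θ|Θ|)² + ∫|∇θ|²|Θ|²)`: the weight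
is a.e. finite against `|Θ|²` (finite energy), `θ` is bounded on the cell, and all real densities
are integrable. [folklore] -/
theorem b4_lintegral_part (hW : Measurable W)
    (hEW : ∀ Ψ : PeriodicTrialState N L, periodicEnergy v Ψ =
      ∫⁻ X in cellN N L, kineticDensity Ψ.ψ X + W X * ((‖Ψ.ψ X‖₊ : ℝ≥0∞)) ^ 2)
    (hreal : ∀ X, Θ.ψ X = (‖Θ.ψ X‖ : ℂ)) (hfin : periodicEnergy v Θ ≠ ⊤)
    (hmin : ∀ Ψ : PeriodicTrialState N L, periodicEnergy v Θ ≤ periodicEnergy v Ψ)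
    {θ : Config N → ℝ} (hθ : ContDiff ℝ 1 θ) (hθper : IsLatticePeriodic L θ)
    (hθsymm : ∀ (σ : Equiv.Perm (Fin N)) (X : Config N), θ (X ∘ σ) = θ X) :
    ∫⁻ X in cellN N L,
        (ENNReal.ofReal (gradDot (fun Y => θ Y * ‖Θ.ψ Y‖) (fun Y => θ Y * ‖Θ.ψ Y‖) X) +
          W X * ENNReal.ofReal ((θ X * ‖Θ.ψ X‖) ^ 2)) =
      ENNReal.ofReal ((periodicEnergy v Θ).toReal * (∫ X in cellN N L, (θ X * ‖Θ.ψ X‖) ^ 2) +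
        dirichletFormW L (fun X => ‖Θ.ψ X‖) θ θ) := by
  have hfin' : (∫⁻ X in cellN N L, kineticDensity Θ.ψ X + W X * ((‖Θ.ψ X‖₊ : ℝ≥0∞)) ^ 2) ≠ ⊤ := by
    rw [← hEW Θ]; exact hfin
  have hG : ContDiff ℝ 1 (fun Y => θ Y * ‖Θ.ψ Y‖) := hθ.mul (contDiff_norm_of_real Θ hreal)
  -- `θ` is bounded on the cell
  obtain ⟨M, -, hM⟩ := exists_bound_on_cellN hθ.continuous L
  -- integrability of the two real densities
  have hint1 : IntegrableOn
      (fun X => gradDot (fun Y => θ Y * ‖Θ.ψ Y‖) (fun Y => θ Y * ‖Θ.ψ Y‖) X) (cellN N L) :=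
    integrableOn_cellN (continuous_gradDot hG hG) L
  have hint2 : IntegrableOn (fun X => (W X).toReal * (θ X * ‖Θ.ψ X‖) ^ 2) (cellN N L) := by
    have h0 := integrableOn_toReal_weight_mul_norm_sq (Θ := Θ) hW hfin'
    have hfun : (fun X => (W X).toReal * (θ X * ‖Θ.ψ X‖) ^ 2) =
        fun X => θ X ^ 2 * ((W X).toReal * ‖Θ.ψ X‖ ^ 2) := by
      funext X; ring
    rw [hfun]
    refine Integrable.bdd_mul h0 ((hθ.continuous.pow 2).aestronglyMeasurable) (c := M ^ 2) ?_
    rw [ae_restrict_iff' (measurableSet_cellN N L)]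
    refine ae_of_all _ fun X hX => ?_
    rw [Real.norm_eq_abs, abs_pow]
    have h1 := hM X hX
    have h2 := abs_nonneg (θ X)
    nlinarith
  rw [lintegral_add_left (continuous_gradDot hG hG).measurable.ennreal_ofReal,
    ← ofReal_integral_eq_lintegral_ofReal hint1 (ae_of_all _ fun X => gradDot_self_nonneg _ X)]
  have e2 : ∫⁻ X in cellN N L, W X * ENNReal.ofReal ((θ X * ‖Θ.ψ X‖) ^ 2) =
      ENNReal.ofReal (∫ X in cellN N L, (W X).toReal * (θ X * ‖Θ.ψ X‖) ^ 2) := by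
    rw [ofReal_integral_eq_lintegral_ofReal hint2
      (ae_of_all _ fun X => mul_nonneg ENNReal.toReal_nonneg (sq_nonneg _))]
    exact lintegral_congr_ae (ae_weight_mul_ofReal_eq hW hfin' θ)
  rw [e2, ← ENNReal.ofReal_add (integral_nonneg fun X => gradDot_self_nonneg _ X)
    (integral_nonneg fun X => mul_nonneg ENNReal.toReal_nonneg (sq_nonneg _)),
    b4_real_gsRep hW hEW hreal hfin hmin hθ hθper hθsymm]

end RealPart

/-! ### The registered stub -/

/-- **B4 `stub_energyFloorToPoincareFloor`** (statement verbatim from the checked skeleton of the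
line `stable-fraction-square-completion`; ground-state transform).  If `Θ` is a real non-negative,
translation-invariant periodic trial state ATTAINING the finite periodic ground-state energy, then
an energy floor `E₀ + ω ≤ inf sp H(p)` in the momentum sector `p = 2πm/L` transfers to the
Poincaré constant of the weight: `ω ≤ ω_Θ(p)`.  For a Bloch-`p` test `F` the transform
`Θ.gsTransform` lies in the sector, and `⟨FΘ,(H − E₀)FΘ⟩ = 𝓔_Θ(F)` by the weak Euler–Lagrange
equation of the minimiser applied to the real and imaginary parts of `F`.
[cite: Davies1989, §4.2 Thm 4.2.1 (proof), pp. 109–110] -/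
theorem stub_energyFloorToPoincareFloor :
    ∀ (v : ℝ → ℝ≥0∞) (N : ℕ) (L : ℝ), 0 < L → ∀ (Θ : PeriodicTrialState N L),
      (∀ X, Θ.ψ X = (‖Θ.ψ X‖ : ℂ)) → HasTotalMomentum 0 Θ.ψ →
      periodicEnergy v Θ = periodicGroundStateEnergy v N L → periodicEnergy v Θ ≠ ⊤ →
      ∀ (m : Fin 3 → ℤ) (ω : ℝ), 0 ≤ ω →
        periodicGroundStateEnergy v N L + ENNReal.ofReal ω ≤
            momentumSectorEnergy v N L (latticeVec (2 * Real.pi / L) m) →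
        ENNReal.ofReal ω ≤ sectorPoincareConstant L Θ.ψ (latticeVec (2 * Real.pi / L) m) := by
  intro v N L _hL Θ hreal hΘ0 hE0 hfin m ω hω hfloor
  refine le_sectorPoincareConstant_iff.2 fun F hF h0 ht => ?_
  -- a measurable weight computing all energies; minimality of `Θ`
  obtain ⟨W, hW, -, -, hEW⟩ := exists_measurable_weight v N L
  have hmin : ∀ Ψ : PeriodicTrialState N L, periodicEnergy v Θ ≤ periodicEnergy v Ψ := fun Ψ => by
    rw [hE0]; exact periodicGroundStateEnergy_le v Ψ
  -- the real data `|Θ|`, `F₁ = Re F`, `F₂ = Im F`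
  have hθ₀ : ContDiff ℝ 1 fun X => ‖Θ.ψ X‖ := contDiff_norm_of_real Θ hreal
  have hF₁ : ContDiff ℝ 1 fun X => (F X).re := Complex.reCLM.contDiff.comp hF.contDiff
  have hF₂ : ContDiff ℝ 1 fun X => (F X).im := Complex.imCLM.contDiff.comp hF.contDiff
  have hF₁per : IsLatticePeriodic L fun X => (F X).re := fun X i a => by
    simp only [hF.periodic X i a]
  have hF₂per : IsLatticePeriodic L fun X => (F X).im := fun X i a => by
    simp only [hF.periodic X i a]
  have hF₁symm : ∀ (σ : Equiv.Perm (Fin N)) (X : Config N), (F (X ∘ σ)).re = (F X).re :=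
    fun σ X => by rw [hF.symm σ X]
  have hF₂symm : ∀ (σ : Equiv.Perm (Fin N)) (X : Config N), (F (X ∘ σ)).im = (F X).im :=
    fun σ X => by rw [hF.symm σ X]
  -- the product `FΘ` in real form
  have hΦd : Differentiable ℝ fun Y => F Y * Θ.ψ Y :=
    hF.differentiable.mul (Θ.contDiff.differentiable one_ne_zero)
  have hreY : ∀ Y, (F Y * Θ.ψ Y).re = (F Y).re * ‖Θ.ψ Y‖ := fun Y => by
    conv_lhs => rw [hreal Y]
    rw [Complex.re_mul_ofReal]
  have himY : ∀ Y, (F Y * Θ.ψ Y).im = (F Y).im * ‖Θ.ψ Y‖ := fun Y => by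
    conv_lhs => rw [hreal Y]
    rw [Complex.im_mul_ofReal]
  have hnY : ∀ X, ‖F X * Θ.ψ X‖ ^ 2 =
      ((F X).re * ‖Θ.ψ X‖) ^ 2 + ((F X).im * ‖Θ.ψ X‖) ^ 2 := fun X => by
    rw [Complex.sq_norm, Complex.normSq_apply, hreY, himY]; ring
  have hpt : ∀ X, kineticDensity (fun Y => F Y * Θ.ψ Y) X +
      W X * ((‖F X * Θ.ψ X‖₊ : ℝ≥0∞)) ^ 2 =
      (ENNReal.ofReal (gradDot (fun Y => (F Y).re * ‖Θ.ψ Y‖) (fun Y => (F Y).re * ‖Θ.ψ Y‖) X) +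
        W X * ENNReal.ofReal (((F X).re * ‖Θ.ψ X‖) ^ 2)) +
      (ENNReal.ofReal (gradDot (fun Y => (F Y).im * ‖Θ.ψ Y‖) (fun Y => (F Y).im * ‖Θ.ψ Y‖) X) +
        W X * ENNReal.ofReal (((F X).im * ‖Θ.ψ X‖) ^ 2)) := by
    intro X
    have hk := b4_kineticDensity_eq_ofReal_gradDot hΦd X
    simp only [hreY, himY] at hk
    rw [hk, ENNReal.ofReal_add (gradDot_self_nonneg _ X) (gradDot_self_nonneg _ X),
      coe_nnnorm_sq_eq_ofReal, hnY, ENNReal.ofReal_add (sq_nonneg _) (sq_nonneg _)]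
    ring
  -- the energy form of `FΘ`: `⟨FΘ, H FΘ⟩ = E₀ ‖F‖²_Θ + 𝓔_Θ(F)` in real terms
  have hmeas₁ : Measurable fun X =>
      ENNReal.ofReal (gradDot (fun Y => (F Y).re * ‖Θ.ψ Y‖) (fun Y => (F Y).re * ‖Θ.ψ Y‖) X) +
        W X * ENNReal.ofReal (((F X).re * ‖Θ.ψ X‖) ^ 2) :=
    (continuous_gradDot (hF₁.mul hθ₀) (hF₁.mul hθ₀)).measurable.ennreal_ofReal.add
      (hW.mul (((hF₁.mul hθ₀).continuous.pow 2).measurable.ennreal_ofReal))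
  have hQ : ∫⁻ X in cellN N L, (kineticDensity (fun Y => F Y * Θ.ψ Y) X +
      W X * ((‖F X * Θ.ψ X‖₊ : ℝ≥0∞)) ^ 2) =
      ENNReal.ofReal ((periodicEnergy v Θ).toReal *
          ((∫ X in cellN N L, ((F X).re * ‖Θ.ψ X‖) ^ 2) +
            ∫ X in cellN N L, ((F X).im * ‖Θ.ψ X‖) ^ 2) +
        (dirichletFormW L (fun X => ‖Θ.ψ X‖) (fun X => (F X).re) (fun X => (F X).re) +
          dirichletFormW L (fun X => ‖Θ.ψ X‖) (fun X => (F X).im) (fun X => (F X).im))) := by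
    simp_rw [hpt]
    rw [lintegral_add_left hmeas₁, b4_lintegral_part hW hEW hreal hfin hmin hF₁ hF₁per hF₁symm,
      b4_lintegral_part hW hEW hreal hfin hmin hF₂ hF₂per hF₂symm,
      ← ENNReal.ofReal_add
        (add_nonneg (mul_nonneg ENNReal.toReal_nonneg (integral_nonneg fun X => sq_nonneg _))
          (dirichletFormW_self_nonneg L _ _))
        (add_nonneg (mul_nonneg ENNReal.toReal_nonneg (integral_nonneg fun X => sq_nonneg _))
          (dirichletFormW_self_nonneg L _ _))]
    congr 1
    ring
  -- the weighted norm and the ground-state form in real terms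
  have hi₁ : IntegrableOn (fun X => ((F X).re * ‖Θ.ψ X‖) ^ 2) (cellN N L) :=
    integrableOn_cellN (((hF₁.mul hθ₀).continuous).pow 2) L
  have hi₂ : IntegrableOn (fun X => ((F X).im * ‖Θ.ψ X‖) ^ 2) (cellN N L) :=
    integrableOn_cellN (((hF₂.mul hθ₀).continuous).pow 2) L
  have hI : weightedNormSq L Θ.ψ F = ENNReal.ofReal
      ((∫ X in cellN N L, ((F X).re * ‖Θ.ψ X‖) ^ 2) +
        ∫ X in cellN N L, ((F X).im * ‖Θ.ψ X‖) ^ 2) := by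
    rw [weightedNormSq_eq]
    simp_rw [coe_nnnorm_sq_eq_ofReal, hnY]
    rw [← integral_add hi₁ hi₂]
    exact (ofReal_integral_eq_lintegral_ofReal (hi₁.add hi₂)
      (ae_of_all _ fun X => add_nonneg (sq_nonneg _) (sq_nonneg _))).symm
  have hd₁ := integrableOn_gradDot_mul_sq hθ₀.continuous hF₁ hF₁ L
  have hd₂ := integrableOn_gradDot_mul_sq hθ₀.continuous hF₂ hF₂ L
  have hD : groundStateDirichletForm L Θ.ψ F = ENNReal.ofReal
      (dirichletFormW L (fun X => ‖Θ.ψ X‖) (fun X => (F X).re) (fun X => (F X).re) +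
        dirichletFormW L (fun X => ‖Θ.ψ X‖) (fun X => (F X).im) (fun X => (F X).im)) := by
    unfold groundStateDirichletForm dirichletFormW
    have hptD : ∀ X, kineticDensity F X * ((‖Θ.ψ X‖₊ : ℝ≥0∞)) ^ 2 = ENNReal.ofReal
        (gradDot (fun Y => (F Y).re) (fun Y => (F Y).re) X * ‖Θ.ψ X‖ ^ 2 +
          gradDot (fun Y => (F Y).im) (fun Y => (F Y).im) X * ‖Θ.ψ X‖ ^ 2) := by
      intro X
      rw [b4_kineticDensity_eq_ofReal_gradDot hF.differentiable X, coe_nnnorm_sq_eq_ofReal,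
        ← ENNReal.ofReal_mul (add_nonneg (gradDot_self_nonneg _ X) (gradDot_self_nonneg _ X)),
        add_mul]
    simp_rw [hptD]
    rw [← integral_add hd₁ hd₂]
    exact (ofReal_integral_eq_lintegral_ofReal (hd₁.add hd₂) (ae_of_all _ fun X =>
      add_nonneg (mul_nonneg (gradDot_self_nonneg _ X) (sq_nonneg _))
        (mul_nonneg (gradDot_self_nonneg _ X) (sq_nonneg _)))).symm
  -- abbreviate the real numbers
  set n : ℝ := (∫ X in cellN N L, ((F X).re * ‖Θ.ψ X‖) ^ 2) +
    ∫ X in cellN N L, ((F X).im * ‖Θ.ψ X‖) ^ 2 with hn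
  set D : ℝ := dirichletFormW L (fun X => ‖Θ.ψ X‖) (fun X => (F X).re) (fun X => (F X).re) +
    dirichletFormW L (fun X => ‖Θ.ψ X‖) (fun X => (F X).im) (fun X => (F X).im) with hDdef
  -- the energy of the ground-state transform `Ψ_F = FΘ/‖FΘ‖`
  set I := ∫⁻ X in cellN N L, ((‖F X * Θ.ψ X‖₊ : ℝ≥0∞)) ^ 2 with hIdef
  have hIw : I = weightedNormSq L Θ.ψ F := (weightedNormSq_eq L Θ.ψ F).symm
  have hI0 : I ≠ 0 := by rwa [hIw]
  have hItop : I ≠ ⊤ := by rwa [hIw]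
  have hIpos : 0 < I.toReal := ENNReal.toReal_pos hI0 hItop
  have hc2 : ((‖((Real.sqrt I.toReal)⁻¹ : ℂ)‖₊ : ℝ≥0∞)) ^ 2 = I⁻¹ := by
    rw [coe_nnnorm_sq_eq_ofReal, norm_inv, Complex.norm_real,
      Real.norm_of_nonneg (Real.sqrt_nonneg _), inv_pow, Real.sq_sqrt hIpos.le,
      ENNReal.ofReal_inv_of_pos hIpos, ENNReal.ofReal_toReal hItop]
  have hψ : (Θ.gsTransform hF h0 ht).ψ =
      fun Y => ((Real.sqrt I.toReal)⁻¹ : ℂ) * (F Y * Θ.ψ Y) := rfl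
  have hEΨ : periodicEnergy v (Θ.gsTransform hF h0 ht) =
      I⁻¹ * ∫⁻ X in cellN N L, (kineticDensity (fun Y => F Y * Θ.ψ Y) X +
        W X * ((‖F X * Θ.ψ X‖₊ : ℝ≥0∞)) ^ 2) := by
    rw [hEW, ← lintegral_const_mul' _ _ (ENNReal.inv_ne_top.2 hI0), hψ]
    refine lintegral_congr fun X => ?_
    rw [kineticDensity_const_mul_complex _ (fun Y => F Y * Θ.ψ Y) X, nnnorm_mul, ENNReal.coe_mul,
      mul_pow, hc2]
    ring
  -- the floor in the sector, evaluated at `Ψ_F`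
  have hfl := hfloor.trans (Θ.momentumSectorEnergy_le_gsTransform v hΘ0 hF h0 ht)
  have hnpos : 0 < n := ENNReal.ofReal_pos.1 (hI ▸ pos_iff_ne_zero.2 h0)
  have hq0 : 0 ≤ (periodicEnergy v Θ).toReal * n + D :=
    add_nonneg (mul_nonneg ENNReal.toReal_nonneg hnpos.le)
      (add_nonneg (dirichletFormW_self_nonneg L _ _) (dirichletFormW_self_nonneg L _ _))
  have hE0' : periodicGroundStateEnergy v N L = ENNReal.ofReal (periodicEnergy v Θ).toReal := by
    rw [ENNReal.ofReal_toReal hfin]; exact hE0.symm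
  rw [hEΨ, hQ, hIw, hI, hE0', ← ENNReal.ofReal_add ENNReal.toReal_nonneg hω,
    ← ENNReal.ofReal_inv_of_pos hnpos, ← ENNReal.ofReal_mul (inv_nonneg.2 hnpos.le),
    ENNReal.ofReal_le_ofReal_iff (mul_nonneg (inv_nonneg.2 hnpos.le) hq0), inv_mul_eq_div,
    le_div_iff₀ hnpos] at hfl
  have hkey : ω * n ≤ D := by nlinarith [hfl]
  -- conclusion
  rw [hI, hD, ← ENNReal.ofReal_mul hω]
  exact ENNReal.ofReal_le_ofReal hkey

end

end Summit.AtomisticToContinuum.BoseEinsteinCondensation.Cruxes.StaticResponseBound.StableFractionSquareCompletion
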